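import Literature.MathematicalPhysics.QuantumFieldTheory.Balaban1983to89.Beta.ExpKernelCalculus

/-!
# `BalabanUV.Beta.GAN24.ZeroModeFubini` — binder row G-an2-4 / (CONV-C), W-slot (pre-trigger; idle-seat one-shot kernel lemma
# «T2-ZERO-MODE-KERNEL*», leaf-02 gen 15): AN ELEVEN-SLOT FUBINI LEMMA AND THE LATTICE TAILS BEHIND THE ZERO-MODE CHARGE OF THE
# LINEAR SECOND-ORDER TRANSPORT `mmRead N (K ∘ vertex2OfK K N T ∘ K)`

NOT IN PRINT; OUR BOOKKEEPING (G-an2-4 formalisation swarm, idle leaf seat `b2b-balaban-gan24-formalise-leaf-02`, gen 15; test (t1) of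
leaf-18 gen 15's note «T₂ ZERO MODE»; module name PROVISIONAL — the row owner gan24-p1 ∕ the (P4) author an2 may rename or re-home it).
HONEST FRAMING (cell contract, verbatim): «discharging `BetaPertH` makes Bałaban's UV stability UNCONDITIONAL — a real constructive-QFT
result; it is NOT the continuum limit and NOT the Clay problem.»  HONEST DEPENDENCY (verbatim): «continuum YM on T⁴ ⇐ BetaPertH ∧ nine
spine estimates (0/9 proved); BetaPertH ⇐ (D1) ∧ (D4) ∧ CAP+tail; G-an2-4 gates asym, D1 and NE2/3/4.»  [folklore] real analysis on
`ℤ^D` only: cites nothing, mints no `def … : Prop`, uses no object of an1∕an2∕an3 beyond `ExpKernelCalculus.Zl` ∕ `l1`, instantiates no wall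
binder, asserts NO shape of Bałaban's tables; «T2Shape» ∕ «T2SupRate» stay LOCATED ∕ OPEN; discharges NOTHING of (hW, hWall); NOT «W-slot
closed», NEVER «G-an2-4 closed»; NOT `BetaPertH`, NOT continuum, NOT Clay.

## What (generic dimension `D`, blocking `N ≥ 1`, finite index types `F`, `I`)

§1 `nested_eleven_comm` — pure rearrangement: if the uncurried integrand `Φ : S⁴ × F × S × F × I × S × I × S → ℝ` is summable on the
   product, the eleven nested sums in the LEFT order `Σ'_{y′} Σ'_{x′} Σ'_{z′} Σ'_{z} Σ_{g} Σ'_{x} Σ_{f} Σ_{κ} Σ'_{u} Σ_{κ′} Σ'_{u′}` (the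
   nesting in which `Σ_{y′ x′ z′} (K ∘ vertex2OfK K N T μ 0 ν y′ ∘ K)(N•x′, N•z′)` unfolds) equal the nested sums in the RIGHT order
   `Σ_{g f κ κ′} Σ'_{u} Σ'_{u′} Σ'_{x} Σ'_{z} Σ'_{y′} Σ'_{x′} Σ'_{z′}` (Mathlib's `Summable.tsum_prod` ∕ `prod_factor` along the explicit
   coordinate reshuffle `reorder`).
§2 lattice tails: sub-sums along the sublattice `N•ℤ^D` (`summable_tsum_exp_sub_zsmul_le`, `…_zsmul_sub_le`: `≤ Zl_D(m)`); the INNER coarse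
   block `inner_block` (`Σ'_{(y′,x′,z′)} e^{−m|u′−N•y′|} e^{−m|N•x′−x|} e^{−m|z−N•z′|} ≤ Zl_D(m)³`, uniformly in the fine points); the OUTER
   four-slot majorant `outerMaj` = `e^{−m|u−u₀|} e^{−δ|u′−u|} e^{−δ|x−u|} e^{−δ|z−u|}`, summable on `(ℤ^D)^4` by the shear `shear4`
   (`summable_outerMaj`); `summable_prod_of_slices` (the nonnegative product criterion with dominated slices).
The integrand, its summability from five exponential leg bounds, the collapse of the three coarse sums and the abstract charge identity are in
`GAN24/ZeroModeSandwich`; the instantiation with an2's `vertex2OfK` ∕ `mmRead` in `GAN24/LinT2ZeroMode`.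
-/

noncomputable section

open Finset
open scoped BigOperators
open Literature.MathematicalPhysics.QuantumFieldTheory
open Literature.MathematicalPhysics.QuantumFieldTheory.Balaban1983to89
open Literature.MathematicalPhysics.QuantumFieldTheory.Balaban1983to89.Beta
open B12Sec2to5 (l1 l1_nonneg)
open ExpKernelCalculus (Zl Zl_nonneg summable_exp_shift summable_exp_shift' tsum_exp_shift tsum_exp_shift' l1_sub_symm)

namespace Summit.QuantumFields.BalabanUV.Beta.GAN24.ZeroModeFubini

/-! ## §1 Pure rearrangement: eleven nested sums (seven lattice, four finite) in two orders -/

section Rearrangement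

variable {S F I : Type*} [Fintype F] [Fintype I]

/-- [folklore] The eleven-slot product in the nesting order of the LEFT side `(y′, x′, z′, z, g, x, f, κ, u, κ′, u′)`. -/
abbrev PiL (S F I : Type*) : Type _ := S × (S × (S × (S × (F × (S × (F × (I × (S × (I × S)))))))))

/-- [folklore] The eleven-slot product in the nesting order of the RIGHT side `(g, f, κ, κ′, u, u′, x, z, y′, x′, z′)`. -/
abbrev PiR (S F I : Type*) : Type _ := F × (F × (I × (I × (S × (S × (S × (S × (S × (S × S)))))))))

/-- [folklore] The coordinate reshuffle between the two nesting orders. -/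
def reorder (S F I : Type*) : PiR S F I ≃ PiL S F I where
  toFun := fun q => (q.2.2.2.2.2.2.2.2.1, (q.2.2.2.2.2.2.2.2.2.1, (q.2.2.2.2.2.2.2.2.2.2, (q.2.2.2.2.2.2.2.1, (q.1, (q.2.2.2.2.2.2.1,
    (q.2.1, (q.2.2.1, (q.2.2.2.2.1, (q.2.2.2.1, q.2.2.2.2.2.1))))))))))
  invFun := fun p => (p.2.2.2.2.1, (p.2.2.2.2.2.2.1, (p.2.2.2.2.2.2.2.1, (p.2.2.2.2.2.2.2.2.2.1, (p.2.2.2.2.2.2.2.2.1, (p.2.2.2.2.2.2.2.2.2.2,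
    (p.2.2.2.2.2.1, (p.2.2.2.1, (p.1, (p.2.1, p.2.2.1))))))))))
  left_inv := fun _ => rfl
  right_inv := fun _ => rfl

/-- [folklore] The uncurried integrand on `PiL`. -/
def uncurryL (Φ : S → S → S → S → F → S → F → I → S → I → S → ℝ) : PiL S F I → ℝ :=
  fun p => Φ p.1 p.2.1 p.2.2.1 p.2.2.2.1 p.2.2.2.2.1 p.2.2.2.2.2.1 p.2.2.2.2.2.2.1 p.2.2.2.2.2.2.2.1 p.2.2.2.2.2.2.2.2.1
    p.2.2.2.2.2.2.2.2.2.1 p.2.2.2.2.2.2.2.2.2.2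

/-- [folklore] **ELEVEN-SLOT FUBINI.**  If the uncurried integrand is summable on the product, the nested sum in the LEFT order
`Σ'_{y′} Σ'_{x′} Σ'_{z′} Σ'_{z} Σ_{g} Σ'_{x} Σ_{f} Σ_{κ} Σ'_{u} Σ_{κ′} Σ'_{u′}` equals the nested sum in the RIGHT order
`Σ_{g} Σ_{f} Σ_{κ} Σ_{κ′} Σ'_{u} Σ'_{u′} Σ'_{x} Σ'_{z} Σ'_{y′} Σ'_{x′} Σ'_{z′}`. -/
theorem nested_eleven_comm (Φ : S → S → S → S → F → S → F → I → S → I → S → ℝ) (hΦ : Summable (uncurryL Φ)) :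
    (∑' y', ∑' x', ∑' z', ∑' z, ∑ g, ∑' x, ∑ f, ∑ κ, ∑' u, ∑ κ', ∑' u', Φ y' x' z' z g x f κ u κ' u')
      = ∑ g, ∑ f, ∑ κ, ∑ κ', ∑' u, ∑' u', ∑' x, ∑' z, ∑' y', ∑' x', ∑' z', Φ y' x' z' z g x f κ u κ' u' := by
  -- LEFT order
  have eL : (∑' p, uncurryL Φ p) = ∑' y', ∑' x', ∑' z', ∑' z, ∑ g, ∑' x, ∑ f, ∑ κ, ∑' u, ∑ κ', ∑' u', Φ y' x' z' z g x f κ u κ' u' := by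
    rw [hΦ.tsum_prod]
    refine tsum_congr fun y' => ?_
    have h1 := hΦ.prod_factor y'
    rw [h1.tsum_prod]
    refine tsum_congr fun x' => ?_
    have h2 := h1.prod_factor x'
    rw [h2.tsum_prod]
    refine tsum_congr fun z' => ?_
    have h3 := h2.prod_factor z'
    rw [h3.tsum_prod]
    refine tsum_congr fun z => ?_
    have h4 := h3.prod_factor z
    rw [h4.tsum_prod, tsum_fintype]
    refine Finset.sum_congr rfl fun g _ => ?_
    have h5 := h4.prod_factor g
    rw [h5.tsum_prod]
    refine tsum_congr fun x => ?_
    have h6 := h5.prod_factor x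
    rw [h6.tsum_prod, tsum_fintype]
    refine Finset.sum_congr rfl fun f _ => ?_
    have h7 := h6.prod_factor f
    rw [h7.tsum_prod, tsum_fintype]
    refine Finset.sum_congr rfl fun κ _ => ?_
    have h8 := h7.prod_factor κ
    rw [h8.tsum_prod]
    refine tsum_congr fun u => ?_
    have h9 := h8.prod_factor u
    rw [h9.tsum_prod, tsum_fintype]
    refine Finset.sum_congr rfl fun κ' _ => ?_
    rfl
  -- RIGHT order
  have hR : Summable (uncurryL Φ ∘ reorder S F I) := (reorder S F I).summable_iff.mpr hΦ
  have eR : (∑' q, (uncurryL Φ ∘ reorder S F I) q)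
      = ∑ g, ∑ f, ∑ κ, ∑ κ', ∑' u, ∑' u', ∑' x, ∑' z, ∑' y', ∑' x', ∑' z', Φ y' x' z' z g x f κ u κ' u' := by
    rw [hR.tsum_prod, tsum_fintype]
    refine Finset.sum_congr rfl fun g _ => ?_
    have h1 := hR.prod_factor g
    rw [h1.tsum_prod, tsum_fintype]
    refine Finset.sum_congr rfl fun f _ => ?_
    have h2 := h1.prod_factor f
    rw [h2.tsum_prod, tsum_fintype]
    refine Finset.sum_congr rfl fun κ _ => ?_
    have h3 := h2.prod_factor κ
    rw [h3.tsum_prod, tsum_fintype]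
    refine Finset.sum_congr rfl fun κ' _ => ?_
    have h4 := h3.prod_factor κ'
    rw [h4.tsum_prod]
    refine tsum_congr fun u => ?_
    have h5 := h4.prod_factor u
    rw [h5.tsum_prod]
    refine tsum_congr fun u' => ?_
    have h6 := h5.prod_factor u'
    rw [h6.tsum_prod]
    refine tsum_congr fun x => ?_
    have h7 := h6.prod_factor x
    rw [h7.tsum_prod]
    refine tsum_congr fun z => ?_
    have h8 := h7.prod_factor z
    rw [h8.tsum_prod]
    refine tsum_congr fun y' => ?_
    have h9 := h8.prod_factor y'
    rw [h9.tsum_prod]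
    refine tsum_congr fun x' => ?_
    rfl
  rw [← eL, ← eR]
  exact ((reorder S F I).tsum_eq (uncurryL Φ)).symm

end Rearrangement

/-! ## §2 Lattice tails: one-variable sums along a sublattice, the inner coarse block, the outer shear -/

section Tails

variable {D N : ℕ} [NeZero N] {m δ : ℝ}

/-- [folklore] Summability on a product from summable slices dominated by a summable function (nonnegative case). -/
theorem summable_prod_of_slices {α β : Type*} (F : α → β → ℝ) (h0 : ∀ a b, 0 ≤ F a b) (hs : ∀ a, Summable fun b => F a b)
    {g : α → ℝ} (hle : ∀ a, ∑' b, F a b ≤ g a) (hg : Summable g) :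
    Summable (fun p : α × β => F p.1 p.2) := by
  refine (summable_prod_of_nonneg ?_).2 ⟨fun a => ?_, ?_⟩
  · exact fun p => h0 p.1 p.2
  · exact hs a
  · exact Summable.of_nonneg_of_le (fun a => tsum_nonneg fun b => h0 a b) hle hg

/-- [folklore] `t ↦ N • t` is injective on `ℤ^D` (`N ≠ 0`). -/
theorem zsmul_injective : Function.Injective (fun t : Fin D → ℤ => (N : ℤ) • t) :=
  smul_right_injective (Fin D → ℤ) (Int.natCast_ne_zero.mpr (NeZero.ne N))

/-- [folklore] `Σ'_{t} e^{−m|v − N•t|₁} ≤ Zl_D(m)` (a sub-sum of the full lattice sum), with summability. -/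
theorem summable_tsum_exp_sub_zsmul_le (hm : 0 < m) (v : Fin D → ℤ) :
    Summable (fun t : Fin D → ℤ => Real.exp (-m * l1 (v - (N : ℤ) • t)))
      ∧ ∑' t : Fin D → ℤ, Real.exp (-m * l1 (v - (N : ℤ) • t)) ≤ Zl D m := by
  have hf := summable_exp_shift (D := D) hm v
  refine ⟨hf.comp_injective zsmul_injective, ?_⟩
  have h := tsum_comp_le_tsum_of_inj hf (fun _ => (Real.exp_pos _).le) (zsmul_injective (N := N))
  rw [tsum_exp_shift v] at h
  exact h

/-- [folklore] `Σ'_{t} e^{−m|N•t − v|₁} ≤ Zl_D(m)`, with summability. -/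
theorem summable_tsum_exp_zsmul_sub_le (hm : 0 < m) (v : Fin D → ℤ) :
    Summable (fun t : Fin D → ℤ => Real.exp (-m * l1 ((N : ℤ) • t - v)))
      ∧ ∑' t : Fin D → ℤ, Real.exp (-m * l1 ((N : ℤ) • t - v)) ≤ Zl D m := by
  have e : (fun t : Fin D → ℤ => Real.exp (-m * l1 ((N : ℤ) • t - v))) = fun t => Real.exp (-m * l1 (v - (N : ℤ) • t)) :=
    funext fun t => by rw [l1_sub_symm]
  rw [e]
  exact summable_tsum_exp_sub_zsmul_le hm v

/-- [folklore] The inner (coarse-block) majorant `e^{−m|u′−N•y′|₁} e^{−m|N•x′−x|₁} e^{−m|z−N•z′|₁}`. -/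
def innerMaj (m : ℝ) (N : ℕ) (u' x z y' x' z' : Fin D → ℤ) : ℝ :=
  Real.exp (-m * l1 (u' - (N : ℤ) • y')) * (Real.exp (-m * l1 ((N : ℤ) • x' - x)) * Real.exp (-m * l1 (z - (N : ℤ) • z')))

/-- [folklore] The inner majorant is nonnegative. -/
theorem innerMaj_nonneg (m : ℝ) (N : ℕ) (u' x z y' x' z' : Fin D → ℤ) : 0 ≤ innerMaj m N u' x z y' x' z' := by
  unfold innerMaj; positivity

/-- [folklore] **THE INNER COARSE BLOCK**: for fixed fine points `u′, x, z` the triple coarse sum of the inner majorant is absolutely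
convergent and `≤ Zl_D(m)³`, UNIFORMLY. -/
theorem inner_block (hm : 0 < m) (u' x z : Fin D → ℤ) :
    Summable (fun j : (Fin D → ℤ) × ((Fin D → ℤ) × (Fin D → ℤ)) => innerMaj m N u' x z j.1 j.2.1 j.2.2)
      ∧ ∑' j : (Fin D → ℤ) × ((Fin D → ℤ) × (Fin D → ℤ)), innerMaj m N u' x z j.1 j.2.1 j.2.2 ≤ Zl D m ^ 3 := by
  obtain ⟨h1, b1⟩ := summable_tsum_exp_sub_zsmul_le (N := N) hm u'
  obtain ⟨h2, b2⟩ := summable_tsum_exp_zsmul_sub_le (N := N) hm x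
  obtain ⟨h3, b3⟩ := summable_tsum_exp_sub_zsmul_le (N := N) hm z
  have h23 : Summable (fun q : (Fin D → ℤ) × (Fin D → ℤ) =>
      Real.exp (-m * l1 ((N : ℤ) • q.1 - x)) * Real.exp (-m * l1 (z - (N : ℤ) • q.2))) :=
    h2.mul_of_nonneg h3 (fun _ => (Real.exp_pos _).le) (fun _ => (Real.exp_pos _).le)
  have h123 := h1.mul_of_nonneg h23 (fun _ => (Real.exp_pos _).le)
    (fun _ => mul_nonneg (Real.exp_pos _).le (Real.exp_pos _).le)
  refine ⟨h123, ?_⟩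
  show ∑' j : (Fin D → ℤ) × ((Fin D → ℤ) × (Fin D → ℤ)), Real.exp (-m * l1 (u' - (N : ℤ) • j.1))
      * (Real.exp (-m * l1 ((N : ℤ) • j.2.1 - x)) * Real.exp (-m * l1 (z - (N : ℤ) • j.2.2))) ≤ Zl D m ^ 3
  rw [← h1.tsum_mul_tsum h23 h123, ← h2.tsum_mul_tsum h3 h23]
  have hZ : 0 ≤ Zl D m := Zl_nonneg hm
  have n2 : 0 ≤ ∑' t : Fin D → ℤ, Real.exp (-m * l1 ((N : ℤ) • t - x)) := tsum_nonneg fun _ => (Real.exp_pos _).le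
  have n3 : 0 ≤ ∑' t : Fin D → ℤ, Real.exp (-m * l1 (z - (N : ℤ) • t)) := tsum_nonneg fun _ => (Real.exp_pos _).le
  calc (∑' t : Fin D → ℤ, Real.exp (-m * l1 (u' - (N : ℤ) • t)))
        * ((∑' t : Fin D → ℤ, Real.exp (-m * l1 ((N : ℤ) • t - x))) * ∑' t : Fin D → ℤ, Real.exp (-m * l1 (z - (N : ℤ) • t)))
      ≤ Zl D m * (Zl D m * Zl D m) := mul_le_mul b1 (mul_le_mul b2 b3 n3 hZ) (mul_nonneg n2 n3) hZ
    _ = Zl D m ^ 3 := by ring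

/-- [folklore] The outer shear `(u, c, a, b) ↦ (u, c + u, a + u, b + u)` of `(ℤ^D)^4`. -/
def shear4 (D : ℕ) : (Fin D → ℤ) × ((Fin D → ℤ) × ((Fin D → ℤ) × (Fin D → ℤ)))
    ≃ (Fin D → ℤ) × ((Fin D → ℤ) × ((Fin D → ℤ) × (Fin D → ℤ))) where
  toFun := fun p => (p.1, (p.2.1 + p.1, (p.2.2.1 + p.1, p.2.2.2 + p.1)))
  invFun := fun p => (p.1, (p.2.1 - p.1, (p.2.2.1 - p.1, p.2.2.2 - p.1)))
  left_inv := fun p => by simp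
  right_inv := fun p => by simp

/-- [folklore] The outer majorant `e^{−m|u−u₀|₁} e^{−δ|u′−u|₁} e^{−δ|x−u|₁} e^{−δ|z−u|₁}`. -/
def outerMaj (m δ : ℝ) (u₀ u u' x z : Fin D → ℤ) : ℝ :=
  Real.exp (-m * l1 (u - u₀)) * Real.exp (-δ * l1 (u' - u)) * Real.exp (-δ * l1 (x - u)) * Real.exp (-δ * l1 (z - u))

/-- [folklore] The outer majorant is nonnegative. -/
theorem outerMaj_nonneg (u₀ u u' x z : Fin D → ℤ) : 0 ≤ outerMaj m δ u₀ u u' x z := by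
  unfold outerMaj; positivity

/-- [folklore] **THE OUTER BLOCK**: the outer majorant is summable on `(ℤ^D)^4` (shear to a product). -/
theorem summable_outerMaj (hm : 0 < m) (hδ : 0 < δ) (u₀ : Fin D → ℤ) :
    Summable (fun o : (Fin D → ℤ) × ((Fin D → ℤ) × ((Fin D → ℤ) × (Fin D → ℤ))) =>
      outerMaj m δ u₀ o.1 o.2.1 o.2.2.1 o.2.2.2) := by
  have g1 : Summable (fun u : Fin D → ℤ => Real.exp (-m * l1 (u - u₀))) := summable_exp_shift' hm u₀
  have g0 : Summable (fun v : Fin D → ℤ => Real.exp (-δ * l1 v)) := by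
    simpa only [sub_zero] using summable_exp_shift' (D := D) hδ 0
  have nn : ∀ v : Fin D → ℤ, 0 ≤ Real.exp (-δ * l1 v) := fun _ => (Real.exp_pos _).le
  have g34 := g0.mul_of_nonneg g0 nn nn
  have g234 := g0.mul_of_nonneg g34 nn (fun _ => mul_nonneg (nn _) (nn _))
  have g1234 := g1.mul_of_nonneg g234 (fun _ => (Real.exp_pos _).le)
    (fun _ => mul_nonneg (nn _) (mul_nonneg (nn _) (nn _)))
  have hsh : Summable ((fun o : (Fin D → ℤ) × ((Fin D → ℤ) × ((Fin D → ℤ) × (Fin D → ℤ))) =>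
      outerMaj m δ u₀ o.1 o.2.1 o.2.2.1 o.2.2.2) ∘ shear4 D) := by
    refine g1234.congr fun p => ?_
    simp only [Function.comp_apply, shear4, Equiv.coe_fn_mk, outerMaj, add_sub_cancel_right]
    ring
  exact (shear4 D).summable_iff.mp hsh

end Tails

end Summit.QuantumFields.BalabanUV.Beta.GAN24.ZeroModeFubini
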